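import Mathlib
import Literature.MathematicalPhysics.QuantumLattice.KohnLuttingerRadialProjection
import HarnessLib

/-!
# Crux `CwThesis` (stmt-HubbardSuperconductivity-10438, route `ChiralWindow`), line
`SketchIdeator3` (penalty line, v5 anchor branch) — stub `stub_quarticInvariant`

The **quartic invariant** of momentum space,
`q(k) = Re (k₀ + i k₁)⁴ / |k|⁴ = (k₀⁴ - 6 k₀² k₁² + k₁⁴) / (k₀² + k₁²)²` (junk value `0` at
`k = 0`, as `x / 0 = 0`), used by the line to modulate a channel state by `D₄`-invariant sign
patterns:

* `quartic_rotMomentum`, `quartic_reflMomentum`, `quartic_rotMomentum_iterate`,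
  `quartic_d4Momentum` — `q` is invariant under the generators `rot : (k₀,k₁) ↦ (-k₁,k₀)` and
  `refl : (k₀,k₁) ↦ (k₀,-k₁)` of the point group `D₄` (numerator and denominator are each
  invariant), hence under every `γ ∈ D₄` (`d4Momentum (r i) = rotⁱ`,
  `d4Momentum (sr i) = refl ∘ rotⁱ`);
* `cos_four_mul_eq_quartic`, `quartic_fermiPolar` — `cos 4θ = cos⁴θ - 6 cos²θ sin²θ + sin⁴θ`, so on
  the polar parametrisation `fermiPolar μ θ = u_μ(θ) (cos θ, sin θ)` of the square-lattice Fermi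
  curve at a level `-4 < μ < 0` (`u_μ(θ) > 0`, `bandFermiRadius_pos`) the quartic equals `cos 4θ`;
* `measurable_quartic` — `q` is Borel measurable (a quotient of polynomials in the continuous
  coordinates `k ↦ k₀`, `k ↦ k₁`);
* `stub_quarticInvariant` — the registered stub (the conjunction of the three).

Everything is elementary (double-angle formulas, `Measurable.div`); no definition is introduced —
the quartic is written out as a lambda at every occurrence, exactly as in the registered stub.
[folklore]
-/

noncomputable section

namespace Summit.HubbardSuperconductivity.HubbardSuperconductivity.Theorems.CwThesis

-- the tree's namespace repeats the summit name by design (D-0017)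
set_option linter.dupNamespace false

open MeasureTheory Literature.MathematicalPhysics.QuantumLattice

/-! ### `D₄`-invariance -/

/-- The quartic is invariant under the quarter turn `(k₀, k₁) ↦ (-k₁, k₀)`. [folklore] -/
theorem quartic_rotMomentum (k : Momentum) :
    (fun k : Momentum => (k 0 ^ 4 - 6 * k 0 ^ 2 * k 1 ^ 2 + k 1 ^ 4) / (k 0 ^ 2 + k 1 ^ 2) ^ 2)
        (rotMomentum k) =
      (fun k : Momentum => (k 0 ^ 4 - 6 * k 0 ^ 2 * k 1 ^ 2 + k 1 ^ 4) / (k 0 ^ 2 + k 1 ^ 2) ^ 2) k := by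
  have hn : (-k 1) ^ 4 - 6 * (-k 1) ^ 2 * k 0 ^ 2 + k 0 ^ 4 =
      k 0 ^ 4 - 6 * k 0 ^ 2 * k 1 ^ 2 + k 1 ^ 4 := by ring
  have hd : ((-k 1) ^ 2 + k 0 ^ 2) ^ 2 = (k 0 ^ 2 + k 1 ^ 2) ^ 2 := by ring
  simp only [rotMomentum_apply_zero, rotMomentum_apply_one, hn, hd]

/-- The quartic is invariant under the reflection `(k₀, k₁) ↦ (k₀, -k₁)`. [folklore] -/
theorem quartic_reflMomentum (k : Momentum) :
    (fun k : Momentum => (k 0 ^ 4 - 6 * k 0 ^ 2 * k 1 ^ 2 + k 1 ^ 4) / (k 0 ^ 2 + k 1 ^ 2) ^ 2)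
        (reflMomentum k) =
      (fun k : Momentum => (k 0 ^ 4 - 6 * k 0 ^ 2 * k 1 ^ 2 + k 1 ^ 4) / (k 0 ^ 2 + k 1 ^ 2) ^ 2) k := by
  have hn : k 0 ^ 4 - 6 * k 0 ^ 2 * (-k 1) ^ 2 + (-k 1) ^ 4 =
      k 0 ^ 4 - 6 * k 0 ^ 2 * k 1 ^ 2 + k 1 ^ 4 := by ring
  have hd : (k 0 ^ 2 + (-k 1) ^ 2) ^ 2 = (k 0 ^ 2 + k 1 ^ 2) ^ 2 := by ring
  simp only [reflMomentum_apply_zero, reflMomentum_apply_one, hn, hd]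

/-- The quartic is invariant under every iterate of the quarter turn. [folklore] -/
theorem quartic_rotMomentum_iterate (n : ℕ) (k : Momentum) :
    (fun k : Momentum => (k 0 ^ 4 - 6 * k 0 ^ 2 * k 1 ^ 2 + k 1 ^ 4) / (k 0 ^ 2 + k 1 ^ 2) ^ 2)
        (rotMomentum^[n] k) =
      (fun k : Momentum => (k 0 ^ 4 - 6 * k 0 ^ 2 * k 1 ^ 2 + k 1 ^ 4) / (k 0 ^ 2 + k 1 ^ 2) ^ 2) k := by
  induction n generalizing k with
  | zero => rfl
  | succ n ih => exact (ih (rotMomentum k)).trans (quartic_rotMomentum k)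

/-- **The quartic is `D₄`-invariant**: `q (γ • k) = q k` for every `γ ∈ D₄`
(`d4Momentum (r i) = rotⁱ`, `d4Momentum (sr i) = refl ∘ rotⁱ`). [folklore] -/
theorem quartic_d4Momentum (g : DihedralGroup 4) (k : Momentum) :
    (fun k : Momentum => (k 0 ^ 4 - 6 * k 0 ^ 2 * k 1 ^ 2 + k 1 ^ 4) / (k 0 ^ 2 + k 1 ^ 2) ^ 2)
        (d4Momentum g k) =
      (fun k : Momentum => (k 0 ^ 4 - 6 * k 0 ^ 2 * k 1 ^ 2 + k 1 ^ 4) / (k 0 ^ 2 + k 1 ^ 2) ^ 2) k := by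
  cases g with
  | r i => exact quartic_rotMomentum_iterate i.val k
  | sr i => exact (quartic_reflMomentum _).trans (quartic_rotMomentum_iterate i.val k)

/-! ### The quartic on the Fermi curve -/

/-- `cos 4θ = cos⁴ θ - 6 cos² θ sin² θ + sin⁴ θ` (real part of de Moivre's formula; here from the
double-angle formula applied twice and `cos² + sin² = 1`). [folklore] -/
theorem cos_four_mul_eq_quartic (θ : ℝ) :
    Real.cos (4 * θ) = Real.cos θ ^ 4 - 6 * Real.cos θ ^ 2 * Real.sin θ ^ 2 + Real.sin θ ^ 4 := by
  have h2 : Real.cos (4 * θ) = 2 * (2 * Real.cos θ ^ 2 - 1) ^ 2 - 1 := by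
    rw [show (4 : ℝ) * θ = 2 * (2 * θ) by ring, Real.cos_two_mul, Real.cos_two_mul]
  rw [h2]
  linear_combination (7 * Real.cos θ ^ 2 - Real.sin θ ^ 2 - 1) * Real.cos_sq_add_sin_sq θ

/-- **On the polar parametrisation of the Fermi curve the quartic is `cos 4θ`**: for `-4 < μ < 0`,
`fermiPolar μ θ = u (cos θ, sin θ)` with `u = bandFermiRadius μ θ > 0`, so numerator and
denominator are `u⁴ (cos⁴θ - 6cos²θ sin²θ + sin⁴θ)` and `u⁴`. [folklore] -/
theorem quartic_fermiPolar {μ : ℝ} (hμ₁ : -4 < μ) (hμ₂ : μ < 0) (θ : ℝ) :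
    (fun k : Momentum => (k 0 ^ 4 - 6 * k 0 ^ 2 * k 1 ^ 2 + k 1 ^ 4) / (k 0 ^ 2 + k 1 ^ 2) ^ 2)
        (fermiPolar μ θ) = Real.cos (4 * θ) := by
  have hu := bandFermiRadius_pos hμ₁ hμ₂ θ
  have hD : ((bandFermiRadius μ θ * Real.cos θ) ^ 2 + (bandFermiRadius μ θ * Real.sin θ) ^ 2) ^ 2 =
      bandFermiRadius μ θ ^ 4 := by
    have h2 : (bandFermiRadius μ θ * Real.cos θ) ^ 2 + (bandFermiRadius μ θ * Real.sin θ) ^ 2 =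
        bandFermiRadius μ θ ^ 2 := by
      linear_combination bandFermiRadius μ θ ^ 2 * Real.cos_sq_add_sin_sq θ
    rw [h2]
    ring
  simp only [fermiPolar_apply_zero, fermiPolar_apply_one]
  rw [hD, div_eq_iff (pow_ne_zero 4 hu.ne'), cos_four_mul_eq_quartic]
  ring

/-! ### Measurability -/

/-- The quartic is Borel measurable on momentum space (quotient of polynomials in the continuous
coordinate functions; `x / 0 = 0` is handled by `Measurable.div`). [folklore] -/
theorem measurable_quartic :
    Measurable (fun k : Momentum => (k 0 ^ 4 - 6 * k 0 ^ 2 * k 1 ^ 2 + k 1 ^ 4) / (k 0 ^ 2 + k 1 ^ 2) ^ 2) := by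
  have h0 : Continuous fun k : Momentum => k 0 := PiLp.continuous_apply 2 _ 0
  have h1 : Continuous fun k : Momentum => k 1 := PiLp.continuous_apply 2 _ 1
  have hn : Continuous fun k : Momentum => k 0 ^ 4 - 6 * k 0 ^ 2 * k 1 ^ 2 + k 1 ^ 4 :=
    ((h0.pow 4).sub ((continuous_const.mul (h0.pow 2)).mul (h1.pow 2))).add (h1.pow 4)
  have hd : Continuous fun k : Momentum => (k 0 ^ 2 + k 1 ^ 2) ^ 2 :=
    ((h0.pow 2).add (h1.pow 2)).pow 2
  exact hn.measurable.div hd.measurable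

/-! ### The registered stub -/

/-- **Stub `stub_quarticInvariant`** (line `SketchIdeator3`, v5 anchor branch): the quartic
`q(k) = (k₀⁴ - 6 k₀² k₁² + k₁⁴) / (k₀² + k₁²)²` is `D₄`-invariant, equals `cos 4θ` on the polar
parametrisation `fermiPolar μ θ` of the square-lattice Fermi curve for `-4 < μ < 0`, and is
measurable. [folklore] -/
theorem stub_quarticInvariant :
    (∀ (g : DihedralGroup 4) (k : Momentum),
        (fun k : Momentum => (k 0 ^ 4 - 6 * k 0 ^ 2 * k 1 ^ 2 + k 1 ^ 4) / (k 0 ^ 2 + k 1 ^ 2) ^ 2)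
            (d4Momentum g k) =
          (fun k : Momentum => (k 0 ^ 4 - 6 * k 0 ^ 2 * k 1 ^ 2 + k 1 ^ 4) / (k 0 ^ 2 + k 1 ^ 2) ^ 2) k) ∧
      (∀ μ ∈ Set.Ioo (-4 : ℝ) 0, ∀ θ : ℝ,
        (fun k : Momentum => (k 0 ^ 4 - 6 * k 0 ^ 2 * k 1 ^ 2 + k 1 ^ 4) / (k 0 ^ 2 + k 1 ^ 2) ^ 2)
            (fermiPolar μ θ) = Real.cos (4 * θ)) ∧
      Measurable (fun k : Momentum => (k 0 ^ 4 - 6 * k 0 ^ 2 * k 1 ^ 2 + k 1 ^ 4) / (k 0 ^ 2 + k 1 ^ 2) ^ 2) :=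
  ⟨quartic_d4Momentum, fun _ hμ θ => quartic_fermiPolar hμ.1 hμ.2 θ, measurable_quartic⟩

end Summit.HubbardSuperconductivity.HubbardSuperconductivity.Theorems.CwThesis

end
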